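import Mathlib
import Summits.MatrixMultiplication.MatrixMultiplication.Theorems.SubgroupIdentityDesigns.Negative.CosetCertificate
import Summits.MatrixMultiplication.MatrixMultiplication.Theorems.SubgroupIdentityDesigns.Negative.RegularSL

/-!
# Non-trivial fixers: the complete single-member criterion for `p`-free subgroups (all `p`)

Route `LevelGradedCohnUmans`, crux `SubgroupIdentityDesigns`, the `(m,k) = (2,1)` cell.
**Theorem** (`no_levelOne_design_of_fixers_mem₁/₂/₃`): let `K ≤ Hᵢ` be a subgroup of `GL₂(𝔽_p)`
with `p ∤ |K|` such that EVERY non-zero vector is fixed by some `k ∈ K ∖ 1`.  Then the triple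
`(H₁, H₂, H₃)` carries no level-one identity design — for every `p`, with no TPP and no volume
hypothesis.  Proof: take the FAITHFUL determinant character `η = ψ ∘ log ∘ det`
(`exists_faithful_detChar`: `(𝔽_p)ˣ` is cyclic, `ZMod.stdAddChar` is injective); on a vector
stabiliser `Stab_K(a)` the determinant is injective (`eq_one_of_det_one_of_fix`: a unimodular
`p`-free element fixing a vector is `1`), so `η` restricts to a NON-TRIVIAL homomorphism
`Stab_K(a) → ℂ` and `Σ_{Stab_K(a)} η = 0` (`sum_hom_units_eq_zero`); now apply the character
certificate `no_levelOne_design_of_character_memᵢ` (CosetCertificate).  This subsumes `O₂⁻`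
(NormOneTorusEnds), `K_Δ` / `N(T)` (SplitMonomialPlacements, single member) and the det-fixer
groups (DetFixers), and certifies e.g. `Z·2T` (order 144) and `Z·Ŝ₄` (order 288) in `GL₂(𝔽₁₃)`.
By linear duality the criterion is also necessary for `p`-free `K` (a vector with trivial stabiliser
makes every irreducible representation `Stab`-spherical, so a single-member design exists); that
converse is recorded as data (kit j123653), not proved here.
VALUE = THEOREM, NOT summit progress; the crux item stmt-MatrixMultiplication-14079 is untouched and
remains open.
-/

set_option linter.dupNamespace false

noncomputable section

open scoped BigOperators Classical

open Summit.MatrixMultiplication.MatrixMultiplication.Theorems.LieRankDesigns.Negative (GLm Mat)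

namespace Summit.MatrixMultiplication.MatrixMultiplication.Theorems.SubgroupIdentityDesigns.Negative

section Fixers

variable {p : ℕ} [hp : Fact p.Prime]

/-- **A faithful determinant character.**  There is a multiplicative `η : GL₂(𝔽_p) → ℂ` with
`η 1 = 1` whose kernel is exactly `SL₂(𝔽_p)`: `η = ψ ∘ e⁻¹ ∘ det` with `e : ℤ/(p-1) ≃ (𝔽_p)ˣ` a
cyclic-group isomorphism and `ψ` the (injective) standard additive character of `ℤ/(p-1)`. -/
theorem exists_faithful_detChar :
    ∃ η : GLm p 2 → ℂ, η 1 = 1 ∧ (∀ k k' : GLm p 2, η (k * k') = η k * η k') ∧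
      ∀ k : GLm p 2, η k = 1 → Matrix.det (k : Mat p 2) = 1 := by
  haveI : NeZero (Nat.card (ZMod p)ˣ) := ⟨(Nat.card_pos (α := (ZMod p)ˣ)).ne'⟩
  set e : Multiplicative (ZMod (Nat.card (ZMod p)ˣ)) ≃* (ZMod p)ˣ :=
    zmodCyclicMulEquiv (G := (ZMod p)ˣ) inferInstance with he
  refine ⟨fun k => ZMod.stdAddChar
      (Multiplicative.toAdd (e.symm (Matrix.GeneralLinearGroup.det k))), ?_, ?_, ?_⟩
  · simp only [map_one]
    rw [toAdd_one, AddChar.map_zero_eq_one]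
  · intro k k'
    simp only [map_mul, toAdd_mul, AddChar.map_add_eq_mul]
  · intro k hk
    have h0 : Multiplicative.toAdd (e.symm (Matrix.GeneralLinearGroup.det k)) = 0 :=
      ZMod.injective_stdAddChar (by rw [AddChar.map_zero_eq_one]; exact hk)
    have h1 : e.symm (Matrix.GeneralLinearGroup.det k) = 1 := by
      rw [← ofAdd_toAdd (e.symm _), h0]
      rfl
    have h2 : Matrix.GeneralLinearGroup.det k = 1 := by
      have := congrArg e h1
      rwa [MulEquiv.apply_symm_apply, map_one] at this
    have h3 := congrArg (fun u : (ZMod p)ˣ => (u : ZMod p)) h2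
    simpa [Matrix.GeneralLinearGroup.val_det_apply] using h3

/-- The stabiliser of a vector inside `K`, as a subgroup of `GL₂(𝔽_p)`. -/
theorem exists_stab_subgroup (K : Subgroup (GLm p 2)) (a : Fin 2 → ZMod p) :
    ∃ S : Subgroup (GLm p 2), ∀ s : GLm p 2,
      s ∈ S ↔ s ∈ K ∧ ((s : GLm p 2) : Mat p 2).mulVec a = a := by
  refine ⟨{ carrier := {s | s ∈ K ∧ ((s : GLm p 2) : Mat p 2).mulVec a = a},
            one_mem' := ⟨K.one_mem, by simp⟩,
            mul_mem' := ?_, inv_mem' := ?_ }, fun s => Iff.rfl⟩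
  · rintro s t ⟨hs, hsa⟩ ⟨ht, hta⟩
    refine ⟨K.mul_mem hs ht, ?_⟩
    rw [Units.val_mul, ← Matrix.mulVec_mulVec, hta, hsa]
  · rintro s ⟨hs, hsa⟩
    refine ⟨K.inv_mem hs, ?_⟩
    have h := congrArg (((s⁻¹ : GLm p 2) : Mat p 2).mulVec) hsa
    rw [Matrix.mulVec_mulVec, ← Units.val_mul, inv_mul_cancel, Units.val_one,
      Matrix.one_mulVec] at h
    exact h.symm

/-- **Stabiliser sums of the faithful determinant character vanish.**  If `p ∤ |K|` and the
non-zero vector `a` is fixed by some `s₀ ∈ K ∖ 1`, then `Σ_{s ∈ K, s a = a} η(s) = 0` for every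
multiplicative `η` with kernel `SL₂`. -/
theorem sum_stab_faithful_eq_zero (K : Subgroup (GLm p 2)) (hKp : ¬ p ∣ Nat.card K)
    (η : GLm p 2 → ℂ) (hη1 : η 1 = 1) (hmul : ∀ k k' : GLm p 2, η (k * k') = η k * η k')
    (hfaith : ∀ k : GLm p 2, η k = 1 → Matrix.det (k : Mat p 2) = 1)
    (a : Fin 2 → ZMod p) (ha : a ≠ 0)
    (hfix : ∃ s ∈ K, s ≠ 1 ∧ ((s : GLm p 2) : Mat p 2).mulVec a = a) :
    (∑ s : K, if ((s : GLm p 2) : Mat p 2).mulVec a = a then η s else 0) = 0 := by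
  obtain ⟨S, hS⟩ := exists_stab_subgroup K a
  -- the restriction of `η` to the stabiliser is a non-trivial homomorphism
  let φ : S →* ℂ :=
    { toFun := fun s => η s
      map_one' := by rw [Subgroup.coe_one, hη1]
      map_mul' := fun s t => by rw [Subgroup.coe_mul, hmul] }
  have hφ : φ ≠ 1 := by
    obtain ⟨s₀, hs₀K, hs₀1, hs₀a⟩ := hfix
    intro h1
    have hη : η s₀ = 1 := by
      have := DFunLike.congr_fun h1 ⟨s₀, (hS s₀).2 ⟨hs₀K, hs₀a⟩⟩
      simpa [φ] using this
    have hN : s₀ ^ Nat.card K = 1 := by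
      have h := pow_card_eq_one' (G := K) (x := ⟨s₀, hs₀K⟩)
      exact congrArg Subtype.val h
    exact hs₀1 (eq_one_of_det_one_of_fix s₀ (hfaith s₀ hη) hKp hN ha hs₀a)
  have hsum := sum_hom_units_eq_zero φ hφ
  -- move both sums to `Finset (GLm p 2)`
  have hL : (∑ s : K, if ((s : GLm p 2) : Mat p 2).mulVec a = a then η s else 0) =
      ∑ x ∈ (Finset.univ.filter fun x : GLm p 2 => x ∈ K),
        if (x : Mat p 2).mulVec a = a then η x else 0 :=
    (Finset.sum_subtype (Finset.univ.filter fun x : GLm p 2 => x ∈ K) (by simp)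
      (fun x : GLm p 2 => if (x : Mat p 2).mulVec a = a then η x else 0)).symm
  have hR : (∑ s : S, φ s) = ∑ x ∈ (Finset.univ.filter fun x : GLm p 2 => x ∈ S), η x :=
    (Finset.sum_subtype (Finset.univ.filter fun x : GLm p 2 => x ∈ S) (by simp)
      (fun x : GLm p 2 => η x)).symm
  rw [hL, ← Finset.sum_filter]
  rw [hR] at hsum
  convert hsum using 2
  ext x
  simp only [Finset.mem_filter, Finset.mem_univ, true_and, hS x]

/-- **NON-TRIVIAL FIXERS ⇒ NO LEVEL-ONE IDENTITY DESIGN, member `H₁`.**  `K ≤ H₁`, `p ∤ |K|`,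
every non-zero vector fixed by some `k ∈ K ∖ 1` ⇒ no design.  All `p`; single member; no TPP. -/
theorem no_levelOne_design_of_fixers_mem₁ {H₁ H₂ H₃ : Subgroup (GLm p 2)}
    (K : Subgroup (GLm p 2)) (hKH : K ≤ H₁) (hKp : ¬ p ∣ Nat.card K)
    (hfix : ∀ a : Fin 2 → ZMod p, a ≠ 0 → ∃ s ∈ K, s ≠ 1 ∧ ((s : GLm p 2) : Mat p 2).mulVec a = a) :
    ¬ ∃ c : Mat p 2 → ℂ, (∀ M, 1 < M.rank → c M = 0) ∧
      (∑ M, c M * ZMod.stdAddChar (Matrix.trace (M * ((1 : GLm p 2) : Mat p 2)))) = 1 ∧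
      ∀ a ∈ H₁, ∀ b ∈ H₂, ∀ g ∈ H₃, a * b * g ≠ 1 →
        (∑ M, c M *
          ZMod.stdAddChar (Matrix.trace (M * ((a * b * g : GLm p 2) : Mat p 2)))) = 0 := by
  obtain ⟨η, hη1, hmul, hfaith⟩ := exists_faithful_detChar (p := p)
  exact no_levelOne_design_of_character_mem₁ K hKH η (by rw [hη1]; exact one_ne_zero)
    (fun k _ s _ => hmul k s)
    (fun a ha => sum_stab_faithful_eq_zero K hKp η hη1 hmul hfaith a ha (hfix a ha))

/-- **NON-TRIVIAL FIXERS ⇒ NO LEVEL-ONE IDENTITY DESIGN, member `H₂`.** -/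
theorem no_levelOne_design_of_fixers_mem₂ {H₁ H₂ H₃ : Subgroup (GLm p 2)}
    (K : Subgroup (GLm p 2)) (hKH : K ≤ H₂) (hKp : ¬ p ∣ Nat.card K)
    (hfix : ∀ a : Fin 2 → ZMod p, a ≠ 0 → ∃ s ∈ K, s ≠ 1 ∧ ((s : GLm p 2) : Mat p 2).mulVec a = a) :
    ¬ ∃ c : Mat p 2 → ℂ, (∀ M, 1 < M.rank → c M = 0) ∧
      (∑ M, c M * ZMod.stdAddChar (Matrix.trace (M * ((1 : GLm p 2) : Mat p 2)))) = 1 ∧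
      ∀ a ∈ H₁, ∀ b ∈ H₂, ∀ g ∈ H₃, a * b * g ≠ 1 →
        (∑ M, c M *
          ZMod.stdAddChar (Matrix.trace (M * ((a * b * g : GLm p 2) : Mat p 2)))) = 0 := by
  obtain ⟨η, hη1, hmul, hfaith⟩ := exists_faithful_detChar (p := p)
  exact no_levelOne_design_of_character_mem₂ K hKH η (by rw [hη1]; exact one_ne_zero)
    (fun k _ s _ => hmul k s)
    (fun a ha => sum_stab_faithful_eq_zero K hKp η hη1 hmul hfaith a ha (hfix a ha))

/-- **NON-TRIVIAL FIXERS ⇒ NO LEVEL-ONE IDENTITY DESIGN, member `H₃`.** -/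
theorem no_levelOne_design_of_fixers_mem₃ {H₁ H₂ H₃ : Subgroup (GLm p 2)}
    (K : Subgroup (GLm p 2)) (hKH : K ≤ H₃) (hKp : ¬ p ∣ Nat.card K)
    (hfix : ∀ a : Fin 2 → ZMod p, a ≠ 0 → ∃ s ∈ K, s ≠ 1 ∧ ((s : GLm p 2) : Mat p 2).mulVec a = a) :
    ¬ ∃ c : Mat p 2 → ℂ, (∀ M, 1 < M.rank → c M = 0) ∧
      (∑ M, c M * ZMod.stdAddChar (Matrix.trace (M * ((1 : GLm p 2) : Mat p 2)))) = 1 ∧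
      ∀ a ∈ H₁, ∀ b ∈ H₂, ∀ g ∈ H₃, a * b * g ≠ 1 →
        (∑ M, c M *
          ZMod.stdAddChar (Matrix.trace (M * ((a * b * g : GLm p 2) : Mat p 2)))) = 0 := by
  obtain ⟨η, hη1, hmul, hfaith⟩ := exists_faithful_detChar (p := p)
  exact no_levelOne_design_of_character_mem₃ K hKH η (by rw [hη1]; exact one_ne_zero)
    (fun k _ s _ => hmul k s)
    (fun a ha => sum_stab_faithful_eq_zero K hKp η hη1 hmul hfaith a ha (hfix a ha))

end Fixers

end Summit.MatrixMultiplication.MatrixMultiplication.Theorems.SubgroupIdentityDesigns.Negative
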